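import Summits.CriticalPhenomena.PercolationContinuityZ3.Theorems.PercNearOneGluingNoHeavyQuantBlobWalk
import HarnessLib

/-!
# QUANT lane R8, FAR on trees: the block-comb WINDOW CONJECTURES (TW-strong) / (TW-H4) of LEAD-NOTES-G10 N21 (4)/(4′) are FALSE —
# kernel record of postcont-1 g38's witness (refuted variants recorded as negations; nothing here touches FAR)

builds on p205010 (kernel theorem, internal audit signed; external expert review pending)

Support file (`--supports stmt-CriticalPhenomena-4575`), QUANT lane typer seat prim-quant-stmt (gen 14), typer brief (c) ("refuted variants
recorded as negations"); rung R8 of `run/shared/lean/prim/quant/LADDER.md`.  Theorems only; no definitions (the `local notation3` `CB[a, p, m]`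
of `…QuantBlobWalk.lean`, verbatim), no sorries, standard axioms.

The gen-10 lead asked the typer (lane INBOX 2026-08-20T21:25Z (2)(ii)) to type `@[conjecture] def Quant.BlobWindowIneq` := (TW-strong),
refined to (TW-H4) (N21 (4′), README V131–V133; kit censuses j106947 / j107110 / j107421, ≈ 4.4·10⁶ exact instances, 0 violations):
for independent blobs `(a k ≥ 1, g k)_{k<K}`, terminal mass `c`, layer `j`, with `S_k = Σ_{i<k} a i ε i`,
  (TW-strong) `(A + c)·min g > 2j ⟹ T ≥ 0`,   (TW-H4) `A·min g + c > 2j ⟹ T ≥ 0`,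
  `T := Σ_{k<K} [P(S_k ∈ (j − a k, j]) − P(S_k ∈ (j − c − T k − a k, j − c − T k])]`, `T k = Σ_{i∈(k,K)} a i`
(expected opportunities minus expected dangers).  **Both are FALSE** (prim-postcont-1 gen 38, lane INBOX 2026-08-20T22:04Z, exact vertex
engine `postcont/prim-postcont-1-g38/calc/gen38_tw_vertex2.py`: 7 resp. 18 violating vertex classes among 1.1·10⁷; the kit palettes drew sizes
`≤ j + 1` only): blobs `(6, 9/20), (1, 19/20), (1, ·)` root-first, `c = 1`, `j = 2` give `T = 1 − 11/20 − 209/400 = −29/400` (one opportunity —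
the giant at `S_0 = 0` — against the dangers `{S_1 = 0}` and `{S_2 = 1}`), while `(A + c)·min g = 81/20 > 4` and the gates may even be taken
non-decreasing (`T` does not see the last gate).  Re-derived here by hand (module docstring of the theorems) and by this seat's engine
(`prim-quant-stmt-g14/code/check_tw_h4.py`, whose own 6 000-instance census with sizes `≤ j+1` had found 0 violations — the same palette artefact).

* `Quant.BlobWalk.tw_strong_false` — ¬(TW-strong), even with non-decreasing gates.
* `Quant.BlobWalk.tw_H4_false` — ¬(TW-H4), even with non-decreasing gates (its hypothesis is weaker than (TW-strong)'s).
What SURVIVES (lane INBOX l.181): the identities (EX)/(crossing)/(PONR) (`…QuantBlobWalk.lean`, `…QuantBlockCombCount.lean`), the equal-gate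
theorem (`Quant.farTree_blockComb_equalGates`), `BlobWalk.exchange_of_prefixWindow` as a conditional route (its hypothesis must now be supplied
per instance), and FAR itself (every witness, realised as an all-tied block-comb, satisfies FAR with room ≥ 0.10).  [this work]
-/

noncomputable section

namespace Summit.CriticalPhenomena.PercolationContinuityZ3.Theorems

namespace Quant

namespace BlobWalk

open Finset

/-- `CB[a, p, m] t` = probability that the open mass of the first `m` blobs (sizes `a`, gates `p`) is `≤ t` (the recursion of
`…QuantBlobWalk.lean`, verbatim). -/
local notation3 "CB[" a ", " p ", " m "]" =>
  (Nat.rec (motive := fun _ => ℤ → ℝ) (fun t => if (0 : ℤ) ≤ t then (1 : ℝ) else 0)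
    (fun n f t => (p : ℕ → ℝ) n * f (t - ((a : ℕ → ℕ) n : ℤ)) + (1 - (p : ℕ → ℝ) n) * f t) (m : ℕ))

/-- **The window functional of the witness is negative.**  For sizes `(6,1,1)`, gates `(9/20, 19/20, 19/20)`, `c = 1`, `j = 2`:
`Σ_{k<3} [window_k(2) − danger_k] = −29/400` (terms `1`, `−11/20`, `−209/400`). [this work] -/
theorem tw_witness_value :
    ∑ k ∈ Finset.range 3,
      ((CB[(fun k : ℕ => if k = 0 then (6 : ℕ) else 1), (fun k : ℕ => if k = 0 then (9 / 20 : ℝ) else 19 / 20), k] ((2 : ℕ) : ℤ) -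
          CB[(fun k : ℕ => if k = 0 then (6 : ℕ) else 1), (fun k : ℕ => if k = 0 then (9 / 20 : ℝ) else 19 / 20), k]
            (((2 : ℕ) : ℤ) - (((fun k : ℕ => if k = 0 then (6 : ℕ) else 1) k : ℕ) : ℤ))) -
        (CB[(fun k : ℕ => if k = 0 then (6 : ℕ) else 1), (fun k : ℕ => if k = 0 then (9 / 20 : ℝ) else 19 / 20), k]
            (((2 : ℕ) : ℤ) - ((1 : ℕ) : ℤ) -
              ((∑ i ∈ Finset.Ico (k + 1) 3, (fun k : ℕ => if k = 0 then (6 : ℕ) else 1) i : ℕ) : ℤ)) -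
          CB[(fun k : ℕ => if k = 0 then (6 : ℕ) else 1), (fun k : ℕ => if k = 0 then (9 / 20 : ℝ) else 19 / 20), k]
            (((2 : ℕ) : ℤ) - ((1 : ℕ) : ℤ) -
              ((∑ i ∈ Finset.Ico (k + 1) 3, (fun k : ℕ => if k = 0 then (6 : ℕ) else 1) i : ℕ) : ℤ) -
              (((fun k : ℕ => if k = 0 then (6 : ℕ) else 1) k : ℕ) : ℤ)))) = -29 / 400 := by
  set A6 : ℕ → ℕ := fun k : ℕ => if k = 0 then (6 : ℕ) else 1 with hA6
  set P9 : ℕ → ℝ := fun k : ℕ => if k = 0 then (9 / 20 : ℝ) else 19 / 20 with hP9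
  -- the recursion at `m = 0, 1, 2` (literal successors, so that rewriting is syntactic)
  have e0 : ∀ t : ℤ, CB[A6, P9, 0] t = if (0 : ℤ) ≤ t then (1 : ℝ) else 0 := fun t => CB_zero A6 P9 t
  have e1 : ∀ t : ℤ, CB[A6, P9, 1] t = P9 0 * CB[A6, P9, 0] (t - (A6 0 : ℤ)) + (1 - P9 0) * CB[A6, P9, 0] t :=
    fun t => CB_succ A6 P9 0 t
  have e2 : ∀ t : ℤ, CB[A6, P9, 2] t = P9 1 * CB[A6, P9, 1] (t - (A6 1 : ℤ)) + (1 - P9 1) * CB[A6, P9, 1] t :=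
    fun t => CB_succ A6 P9 1 t
  have hA0 : A6 0 = 6 := by simp [hA6]
  have hA1 : A6 1 = 1 := by simp [hA6]
  have hA2 : A6 2 = 1 := by simp [hA6]
  have hP0 : P9 0 = 9 / 20 := by simp [hP9]
  have hP1 : P9 1 = 19 / 20 := by simp [hP9]
  simp only [Finset.sum_range_succ, Finset.sum_range_zero, Finset.sum_Ico_eq_sum_range]
  simp only [e2, e1, e0, hA0, hA1, hA2, hP0, hP1]
  norm_num

/-- **(TW-strong) is false** (LEAD-NOTES-G10 N21 (4); witness of prim-postcont-1 gen 38): it is NOT the case that for all blobs with sizes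
`≥ 1`, gates in `[0,1]` — even non-decreasing — terminal mass `c` and layer `j` with `(Σ a + c)·p k > 2j` for every `k`, the expected number
of opportunities is at least the expected number of dangers.  Witness `(6, 9/20), (1, 19/20), (1, 19/20)`, `c = 1`, `j = 2`: `T = −29/400`.
[this work] -/
theorem tw_strong_false : ¬ (∀ (K : ℕ) (a : ℕ → ℕ) (p : ℕ → ℝ) (c j : ℕ),
    (∀ k, 0 ≤ p k ∧ p k ≤ 1) →
    (∀ k, k < K → 1 ≤ a k) →
    (∀ k k', k ≤ k' → k' < K → p k ≤ p k') →
    (∀ k, k < K → (2 * j : ℝ) < (((∑ i ∈ Finset.range K, a i : ℕ) : ℝ) + c) * p k) →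
    0 ≤ ∑ k ∈ Finset.range K,
      ((CB[a, p, k] (j : ℤ) - CB[a, p, k] ((j : ℤ) - (a k : ℤ))) -
        (CB[a, p, k] ((j : ℤ) - (c : ℤ) - ((∑ i ∈ Finset.Ico (k + 1) K, a i : ℕ) : ℤ)) -
          CB[a, p, k] ((j : ℤ) - (c : ℤ) - ((∑ i ∈ Finset.Ico (k + 1) K, a i : ℕ) : ℤ) - (a k : ℤ))))) := by
  intro h
  have hA : (((∑ i ∈ Finset.range 3, (fun k : ℕ => if k = 0 then (6 : ℕ) else 1) i : ℕ) : ℝ)) = 8 := by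
    simp [Finset.sum_range_succ]
  have key := h 3 (fun k => if k = 0 then 6 else 1) (fun k => if k = 0 then 9 / 20 else 19 / 20) 1 2
    (fun k => by split_ifs <;> norm_num)
    (fun k _ => by split_ifs <;> norm_num)
    (fun k k' hkk' _ => by split_ifs <;> first | (exfalso; omega) | norm_num)
    (fun k hk => by rw [hA]; split_ifs <;> norm_num)
  rw [tw_witness_value] at key
  norm_num at key

/-- **(TW-H4) is false** (LEAD-NOTES-G10 N21 (4′)): the same with the budget hypothesis `(Σ a)·p k + c > 2j` (weaker than (TW-strong)'s, so
this follows from `tw_strong_false`; recorded under its own name).  Witness as above: `8 · 9/20 + 1 = 23/5 > 4`, `T = −29/400`. [this work] -/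
theorem tw_H4_false : ¬ (∀ (K : ℕ) (a : ℕ → ℕ) (p : ℕ → ℝ) (c j : ℕ),
    (∀ k, 0 ≤ p k ∧ p k ≤ 1) →
    (∀ k, k < K → 1 ≤ a k) →
    (∀ k k', k ≤ k' → k' < K → p k ≤ p k') →
    (∀ k, k < K → (2 * j : ℝ) < ((∑ i ∈ Finset.range K, a i : ℕ) : ℝ) * p k + c) →
    0 ≤ ∑ k ∈ Finset.range K,
      ((CB[a, p, k] (j : ℤ) - CB[a, p, k] ((j : ℤ) - (a k : ℤ))) -
        (CB[a, p, k] ((j : ℤ) - (c : ℤ) - ((∑ i ∈ Finset.Ico (k + 1) K, a i : ℕ) : ℤ)) -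
          CB[a, p, k] ((j : ℤ) - (c : ℤ) - ((∑ i ∈ Finset.Ico (k + 1) K, a i : ℕ) : ℤ) - (a k : ℤ))))) := by
  intro h
  refine tw_strong_false fun K a p c j hp ha hmono hreg => h K a p c j hp ha hmono fun k hk => ?_
  -- `(A + c)·p k ≤ A·p k + c` since `p k ≤ 1`
  have h1 := hreg k hk
  have hpk := hp k
  nlinarith [Nat.cast_nonneg (α := ℝ) c, Nat.cast_nonneg (α := ℝ) (∑ i ∈ Finset.range K, a i)]

end BlobWalk

end Quant

end Summit.CriticalPhenomena.PercolationContinuityZ3.Theorems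

end
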